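import Mathlib
import HarnessLib
import HarnessLib.Audit
import Summits.ResolutionOfSingularities.Statement
import HarnessLib.Audit.Status.Attr

/-!
Route: FrobeniusLadder

# Route FrobeniusLadder — Macaulayfication one rung up — F-injective, then F-rational modifications,
then resolve F-rational varieties

It suffices to show, for every prime p and every field k of characteristic p (no perfectness
assumed), three rungs of a ladder of
PROPER BIRATIONAL MODELS typed by closure operations on parameter ideals of the local rings, each
rung stated in TRANSPORT-CLOSED form over
REDUCED separated finite-type X/k (cone repair 2026-08-16: the deciding theorem is then pure logic
over the Statement's own module):
(FInj) every such X has a proper birational model X₁ → X that is locally integral with all local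
rings Cohen–Macaulay and every ideal
generated by a system of parameters FROBENIUS-CLOSED (= CM and F-injective, Fedder 1983); (FRat) if
X has such a model then X has a proper
birational model X₂ → X all of whose local rings are domains with every parameter ideal TIGHTLY
CLOSED (= F-rational, Fedder–Watanabe /
Hochster–Huneke); (FRatRes) if X has an F-rational proper birational model then X has a resolution.
Each rung is equivalent to its
integral 'model' form (integral X; X₁, X₂ integral) modulo in-tree folklore (reduced ⇒ integral
components, disjoint unions of models,
composition/transport of proper birational morphisms: Literature
isBirational_coprodDesc_of_closed_cover, IsBirational.comp,
Scheme.HasResolution.of_isBirational). X = FInj ∧ FRat ∧ FRatRes; the rung below FInj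
(Cohen–Macaulay models = Macaulayfication,
Faltings 1978 / Kawasaki 2000 / Česnavičius 2021) is a THEOREM in all characteristics and dimensions
and is the solved adjacent case whose
mechanism is transferred. Realises the homological-ladder card cluster
(purify-first-fedder-audit-macaulayfication: the Macaulayfication
transplant; test-module-two-chains: the F-rational rung FRat; gorenstein-rung: the ladder), with
F-injective/F-rational as the rungs.
Lean: `FInjectiveMacaulayfication ∧ FRationalModification ∧ FRationalResolution`

## Assembly
Pure logic over `Summits.ResolutionOfSingularities.Statement` alone (certified in glue.lean, `lean
check` rc 0, axioms propext /
Classical.choice / Quot.sound): unfold `ResolutionOfSingularities_iff`, fix p prime, k, a reduced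
separated finite-type X/k, and chain
FRationalResolution ∘ FRationalModification ∘ FInjectiveMacaulayfication at that X. No Literature
lemma is used by the deciding theorem; the
reduction to integral schemes and the transport of resolutions along proper birational maps now sit
inside the cruxes, where they are
folklore relative to the cruxes' content.

Rationale: WHY THIS LINE. Operator "adjacent transfer": the nearest SOLVED weakening of the summit valid in
every characteristic and dimension is Macaulayfication
(doi:10.1007/bf01424774 Faltings 1978; doi:10.1090/s0002-9947-00-02603-9 Kawasaki 2000 Thm 1.1;
arXiv:1810.04493 Česnavičius Thm 1.6,
"reduce the resolution of singularities to the Cohen–Macaulay case", §1), proved by Noetherian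
induction on the non-CM locus with blow-ups of
possibly non-reduced ideals built from systems of parameters chosen inside UNIFORM ANNIHILATORS of
the deficiency modules H^i_m (i < dim) — a
move no regular-centre algorithm can make (Česnavičius §1). Dictionary of the transfer (commutative
algebra of Frobenius, imported from
tight-closure theory): CM = "every s.o.p. is a regular sequence" ↦ F-injective-CM = "every s.o.p.
ideal is Frobenius closed" (Fedder
doi:10.2307/1999165; arXiv:1601.02524 p.3) ↦ F-rational = "every s.o.p. ideal is tightly closed"
(doi:10.2307/2154942 HH94 §4) ↦ regular =
"every ideal tightly closed + Kunz"; annihilator input H^i_m ↦ Hartshorne–Speiser–Lyubeznik uniform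
nilpotence of the F-nilpotent part of
H^d_m and finiteness of F-stable submodules (arXiv:0708.0553) ↦ parameter test elements (powers of
Jacobian elements, HH94 §6) annihilating
0^*_{H^d_m} uniformly and compatibly with localisation. WHAT BREAKS: Kawasaki's blow-up lemma kills
H^i_m for i < d by making parameters a
regular sequence upstairs (a depth phenomenon); the Frobenius kernel on the TOP local cohomology and
the tight-closure defect ω/τ(ω) are not
depth phenomena and no blow-up lemma for them is known — cruxes FInjectiveMacaulayfication and
FRationalModification are exactly the two
repairs. WHY EASIER than the summit: each rung is a statement about ONE closure operation on
parameter ideals with a uniform annihilator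
theory and good behaviour under localisation/alteration (arXiv:1107.3807 Cor. on F-rationality: X
F-rational ⇔ CM and the trace
π_*ω_Y → ω_X is surjective for every — equivalently one regular (de Jong) — alteration, so FRat =
"make de Jong's alteration trace
surjective on ω by a modification"), and the residual class of FRatRes is genuinely smaller:
F-rational ⇒ normal, CM, pseudo-rational
(doi:10.1353/ajm.1997.0007), multiplicity ≤ C(embdim−1, dim−1) (arXiv:1310.0584 Thm 3.1), and for
hypersurface (Gorenstein) points
F-rational = F-regular ⇒ F-pure ⇒ f^(p−1) ∉ m^[p] (Fedder), which EXCLUDES every catalogued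
characteristic-p specimen (kangaroo, Moh,
Hauser–Perlega, Cossart–Piltant Rem 3.2, Narasimhan, Hironaka's quadric all lie in m^[p]: support
CPSpecimenNotFClosed is the Lean-sized
instance) — the wild core t^p = a of routes Valuative / pAlteration / CyclicCovers is removed by the
lower rungs instead of being uniformized.
No existing route uses local cohomology, Frobenius/tight closure of ideals or non-reduced
homological centres; no field reduction is needed
(all k at once, so Literature.Barriers…InseparableBaseChange is never met); negatives index empty.

RANKED CRUXES. #2 FInjectiveMacaulayfication (crux) — F-INJECTIVE MACAULAYFICATION (transport-closed
form over reduced X). For every prime p, field k of char p and reduced separated k-scheme X of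
finite type there is a proper birational π : X' → X such that every local ring O_{X',x} is a domain
(X' locally integral) and for every system of parameters s of O_{X',x} (d = dim O_{X',x} elements
generating an ideal with maximal radical) s is a regular sequence and the ideal (s) is Frobenius
closed (y^(p^e) ∈ (s)^[p^e] ⇒ y ∈ (s)) — i.e. X' is locally integral, Cohen–Macaulay and F-injective
(the transferred Kawasaki engine one rung up; card purify-first T1 with F-injective in place of
F-pure). Equivalent to the integral form (integral X, integral X') modulo folklore: resolve the
finitely many integral components and take the disjoint union (Literature isProper_coprodDesc,
isBirational_coprodDesc_of_closed_cover). [difficulty: open-problem] (why it might fail: Kawasaki's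
lemma is a depth statement (H^i_m, i<dim); the Frobenius kernel on the TOP H^d_m has infinite length
off isolated points and no blow-up is known to shrink it while keeping CM — F-injectivization may be
as hard as F-rationalification.) [doi:10.1090/s0002-9947-00-02603-9, arXiv:1810.04493,
doi:10.1007/bf01424774, doi:10.2307/1999165, arXiv:1601.02524, arXiv:0708.0553, doi:10.2307/1971025]
ATTACK / FIRST LEMMA (judge repair 2026-08-17; the 06:45Z judge's what_would_move_it was 'an
explicit blow-up shrinking the Frobenius kernel on H^d_m while preserving CM for one non-F-injective
3-fold germ'): filed as the supports ThreefoldFInjectiveBlowup (scheme level, L) and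
ThreefoldStrictTransformFedder (polynomial level, provable now) below. Germ: the char-2 threefold f
= X₀²X₁+X₁²X₂+X₂²X₀+X₀X₃³+X₁X₂X₃² = 0 in A⁴ — integral, isolated triple point, Cohen–Macaulay, NOT
F-injective at 0 (f ∈ m^[2]; the parameter ideal (x₀+x₁,x₂,x₃) is not Frobenius closed, witness
x₀²). Blow-up of the closed point (reduced centre m): charts X₀,X₁,X₂ regular along E (a partial
derivative ≡ 1 mod Xᵢ), chart X₃ = {X₀²X₁+X₁²X₂+X₂²X₀+X₃(X₀+X₁X₂) = 0} regular off its origin and at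
its origin — the UNIQUE singular point upstairs, a cA-type double point — Fedder's test PASSES
(monomials X₀X₃, X₁X₂X₃ ∉ (Xᵢ²)) while the point stays singular: ker(F | H³_m) ≠ 0 at the input and
= 0 at every point of Bl_m, CM throughout, NOT a resolution — F-injectivization strictly between
Macaulayfication and resolution in dimension 3 (hand computation, cross-checked by brute force over
GF(2^k), k ≤ 4). It instantiates the landed engine interface of line Sketch (Theorems
…FiModelOfCharts p143445, …BlowupFiModel E6′ p137171, …FedderCriterion/FedderOrigin n-variable
Fedder test, …HypersurfaceRegular) one dimension above the landed surface calibrations Bl_m E₈⁰ char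
5 (p139106) and the char-3 two-step tower (p143112, p145076); new in dim 3: 4 charts, Fin 4
strict-transform presentation, exceptional divisor a cone over the supersingular cubic
X₀²X₁+X₁²X₂+X₂²X₀ = 0.
#3 FRationalModification (crux) — F-RATIONALIFICATION OF CM F-INJECTIVE VARIETIES (transport-closed
form). For every prime p, field k of char p and reduced separated finite-type X/k: if X admits a
proper birational model X₁ → X that is locally integral with all local rings CM and all parameter
ideals Frobenius closed (the rung-2 predicate verbatim), then X admits a proper birational model X₂
→ X all of whose local rings are domains in which every ideal generated by a system of parameters is
tightly closed (c·y^(p^e) ∈ (s)^[p^e] for all e with c ≠ 0 ⇒ y ∈ (s)) — i.e. X₂ is F-rational (card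
test-module-two-chains' rung FRat, all dimensions; engine: parameter test elements as the uniform
annihilator of 0^*_{H^d_m} in Kawasaki's induction, BST trace surjectivity as the target).
Equivalent to 'every integral CM F-injective variety has a proper birational F-rational model'
modulo folklore (a locally integral Noetherian X₁ is the disjoint union of its clopen integral
components; compose proper birational maps, Literature IsBirational.comp). [deps:
FInjectiveMacaulayfication] [difficulty: open-problem] (why it might fail: no ideal I with Proj
R[It] F-rational is known for a non-F-rational R beyond dim 2 (Lipman); Rees algebras even of
F-rational rings fail F-rationality (HWY02), and the test module τ(ω) can stay strictly inside ω
along every normal modification tower (two-chains stagnation).) [doi:10.2307/2154942,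
arXiv:1107.3807, doi:10.1006/jabr.2001.8998, arXiv:2305.12383, arXiv:1803.05382, zbl:0910.13005,
doi:10.1353/ajm.1997.0007]
#4 FRationalResolution (crux) — RESOLUTION OF F-RATIONAL VARIETIES (transport-closed form). For
every prime p, field k of char p and reduced separated finite-type X/k: if X admits a proper
birational model X₂ → X all of whose local rings are domains with every parameter ideal tightly
closed (F-rational), then X has a resolution of singularities (proper birational X̃ → X, X̃
regular). Equivalent to 'every integral F-rational variety has a resolution' modulo folklore
(Literature Scheme.HasResolution.of_isBirational; clopen integral components). Ranked last
deliberately: it is the summit restricted to the residual class; the route-specific information is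
in ranks 2–3. [deps: FRationalModification] [difficulty: open-problem] (why it might fail:
F-rationality is no restriction in codimension ≥ 2 phenomena of toric/determinantal type and carries
no known resolution invariant; F-regular hypersurface germs z^p + F (n ≥ p+1 variables, e.g.
z²+xyw+G in char 2) may still host kangaroo-type residual-order jumps.) [arXiv:1310.0584,
doi:10.1353/ajm.1997.0007, doi:10.2307/1999165, arXiv:1412.0868, Kollar2007, arXiv:0807.1654]
#9 RegularStalksClimb (support) — FAITHFULNESS (regular local rings sit on top of the ladder): for
every prime p and every Noetherian regular local ring R of characteristic p, every system of
parameters is a regular sequence and every ideal it generates is tightly closed (hence Frobenius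
closed); so the summit implies each crux (take the model X' = a resolution; regular local rings are
domains). Proof route: Kunz flatness of Frobenius (Literature Kunz1969, PROVED: Kunz1969_holds,
narrow imports) gives (I^[q] : y^q) = (I : y)^[q], then Krull intersection. [difficulty: M]
[doi:10.2307/2154942, doi:10.2307/1971025, Literature.AlgebraicGeometry.Resolution.Kunz1969]
#9 CPSpecimenNotFClosed (support) — CALIBRATION (the wild core is below rung 2): for the
Cossart–Piltant Rem 3.2 hypersurface A = k[u₁,…,u₄,Z]/(Z^p + u₄u₁^p + u₃u₂^p) over any field k of
char p, the parameter ideal I = (u₁,u₂,u₃,u₄) is NOT Frobenius closed: Z ∉ I but Z^p ∈ I^[p]. Hence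
the local ring at the origin is not F-injective-CM and FInjectiveMacaulayfication must modify such
points away (same two-line computation for every barrier-catalogue specimen lying in m^[p]).
[difficulty: provable-now] [arXiv:1412.0868, doi:10.2307/1999165]
#9 ThreefoldFInjectiveBlowup (support) — THREEFOLD CALIBRATION (the judge's Attack-axis first lemma
for #2): for every field k of char 2 and A = k[X₀..X₃]/(X₀²X₁+X₁²X₂+X₂²X₀+X₀X₃³+X₁X₂X₃²): (a) the
parameter ideal I = (x₀+x₁, x₂, x₃) (rad I maximal, A/I = k[x₀]/(x₀³)) has x₀² ∉ I and (x₀²)² ∈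
I^[2] — the input is not F-injective-CM at the origin; (b) Spec A admits a proper birational model
all of whose stalks are domains with every s.o.p. weakly regular and every parameter ideal Frobenius
closed (the rung-2 clause, p = 2) which is NOT regular. Witness: Bl_m Spec A = affineBlowup
(x₀,…,x₃) via E6′ blowupFiModel_of_maximal (off m: Jacobian, ∂f = (X₂²+X₃³, X₀²+X₂X₃², X₁²+X₁X₃²,
X₀X₃²) has no common zero off 0; charts 0–2: ∂₁g₀ ≡ ∂₂g₁ ≡ ∂₀g₂ ≡ 1 mod Xᵢ; chart 3: ∂_{j+1}g₃ ≡
X_j² mod X₃ off the origin, Fedder at the origin, g₃ ∈ (X)² for non-regularity). [deps: —]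
[difficulty: L] [doi:10.2307/1999165, arXiv:1601.02524, doi:10.1006/jabr.1998.7521, StacksProject
Tag 0804]
#9 ThreefoldStrictTransformFedder (support) — THE FEDDER FLIP, polynomial level (the computational
heart of the calibration; provable now, template CPSpecimenNotFClosed / E8Forms): for every field k
of char 2, f as above and g = X₀²X₁+X₁²X₂+X₂²X₀+X₀X₃+X₁X₂X₃: f ∈ (X₀²,…,X₃²) (Fedder fails at the
input point); aeval θ₃ f = X₃³·g for the chart substitution θ₃ : X₃ ↦ X₃, Xⱼ ↦ XⱼX₃ (g is the strict
transform on the X₃-chart); g ∉ (X₀²,…,X₃²) (Fedder passes at the new point); g ∈ (X₀,…,X₃)² (the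
new point is singular); ∂₁g − X₀², ∂₂g − X₁², ∂₀g − X₂² ∈ (X₃) (Jacobian certificates along E off
the origin). [deps: —] [difficulty: provable-now] [doi:10.2307/1999165]

TWO-LAYER PLAN. Foreseen glued splits (k ≤ 3, depth 1), none filed now: FInjectiveMacaulayfication ⇐
IsolatedFInjBlowup (local ring CM-F-injective on the
punctured spectrum ⇒ one blow-up of a Frobenius-standard parameter ideal is CM F-injective: the
Faltings/Goto shape) → CodimStepFInj
(CM-F-injective in codim ≤ c ⇒ in codim ≤ c+1 by a blow-up that is an isomorphism over the good
locus, Česnavičius-style induction) →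
FInjectiveMacaulayfication; FRationalModification ⇐ IsolatedFRatBlowup (isolated non-F-rational CM
point, finite colength of τ(ω) as budget:
card test-module-two-chains) → CodimStepFRat → FRationalModification; FRationalResolution ⇐
(hypersurface/Gorenstein F-regular germs: no
residual-order increase under CJS-permissible blow-ups) → (embedded case) → FRationalResolution.

KILL CRITERIA. Every crux is implied by the summit (support RegularStalksClimb), so no crux is
refutable short of ¬summit: a refutation of any of them in
some characteristic p is a PROBLEM DECIDER — file the witness as refutation evidence, do not merely
close. The route is closed USELESS
(close --reason superseded/exhausted with census) if a refuter shows cheaply that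
FInjectiveMacaulayfication or FRationalModification is
EQUIVALENT to the summit (e.g. every F-injective-ification procedure already resolves), i.e. the
rungs carry no reduction; it is DEMOTED
(dormant) if F-regular hypersurface germs are shown to host the Moh / Hauser–Perlega residual-order
increase (then FRationalResolution has no
why-easier left and the route shrinks to two publishable rungs); a rung found in print becomes
support (not a kill). Proved elsewhere:
any route closing the summit moots it; a proof of Picover (pAlteration) does not.

NOT DECOMPOSED YET. The isolated-singularity and codimension-step forms of ranks 2–3 (Two-layer
plan); the choice of engine inside rank 2 (Frobenius-standard
parameter ideals vs. blowing up Frobenius powers m^[q]·annihilators vs. Schenzel's birational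
Macaulayfication via CM canonical modules
doi:10.1016/j.jalgebra.2003.12.016); the measure for rank 3 (colength of τ(ω) at isolated points;
F-rational signature arXiv:1911.02642
in general); dimension ≤ 3 instances of every rung from (h : CossartPiltant2019) +
RegularStalksClimb; embedded/snc variants; any use of
alterations (BST) inside rank 3. All layer-2, by glued split once rank 2 or 3 moves (D-0019). Also
not filed: the QUANTITATIVE blow-up lemma the threefold calibration is the first datum for — a
measure of the Frobenius kernel on H^d_m (Hartshorne–Speiser–Lyubeznik number / length of the
F-nilpotent part at isolated points, arXiv:0708.0553) that a blow-up of a centre supported on the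
non-F-injective locus strictly DECREASES while keeping CM; point centres cannot be that lemma in
general (survey j023222: a non-F-pure CURVE appears on E for non-absolutely-isolated surface points;
Bl_m E₈⁰ fails in char 3, p143112), so the lemma belongs to the centre recipes of the crux cards
(cartier-contraction-centres, weighted-cone-deformation-descent) and is layer 2 after #2 moves.

CHEAPEST FALSIFIER. (i) Lookup (run 2026-08-16, negative): is "every variety of char p has a proper
birational F-injective (or F-rational) model" in print?
zbMATH "F-rational modification" (1 hit, Smirnov–Tucker signature, unrelated), "F-injective blow-up"
(0), "F-rational birational model
existence" (0), "Macaulayfication F-rational" (AHS96 zbl:0910.13005: tight closure ⇒ CM Rees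
algebras OF F-rational rings — converse
direction), arXiv "F-rationalification" (only Kollár's char-0 RATIONALIFICATION question,
arXiv:1503.06320 p.1, which insists on an
isomorphism over a prescribed open and is open for threefolds even with Hironaka available —
different statement). (ii) Computation a refuter
should run first (kills the why-easier of rank 4, not the logic): Macaulay2 TestIdeals search for
residual-order INCREASE under point blow-ups
among F-REGULAR germs z^p + F(x₁..x_n), n = p+1, p = 2,3 (F-regularity by Glassbrenner's criterion
c·f^(q−1) ∉ m^[q]); e.g. z²+xyw+G, char 2.
(iii) In-Lean sanity (done, redone after the cone repair 2026-08-16): the three restated Props and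
the pure-logic `closes` elaborate with
`import Summits.ResolutionOfSingularities.Statement` only (Sketch.lean rc 0, closes axioms
propext/Classical.choice/Quot.sound); d = 0 stalks
(function fields) satisfy every rung predicate non-vacuously; CPSpecimenNotFClosed shows rung 2 is a
genuine restriction. (iv) Threefold sanity (run 2026-08-17, planner, by hand + brute force over
GF(2^k), k ≤ 4, folder work/threefold_check.py): for the char-2 germ X₀²X₁+X₁²X₂+X₂²X₀+X₀X₃³+X₁X₂X₃²
the singular locus is {0} (1 point over each GF(2^k)), the four strict transforms have exactly one
singular point in total (origin of the X₃-chart, over every GF(2^k) tested and by the Jacobian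
identities), and Fedder's test flips from FAIL (f ∈ m^[2]) to PASS (g₃ ∌ only squares: X₀X₃, X₁X₂X₃)
there — had it failed, as it does for Bl_m E₈⁰ in char 3, the naive point-centre engine would be
dead at step one in dimension 3 for this germ; it is not, and the model is not a resolution.

NUMBERS. Multiplicity bounds: F-pure ⇒ e ≤ C(v,d); F-rational ⇒ e ≤ C(v−1,d−1) (arXiv:1310.0584 Thm
3.1); hence an F-pure hypersurface point of an
n-fold has multiplicity ≤ n+1, and pure-p-th-power initial forms with F-purity need n ≥ p+1 ambient
parameters besides z. Known rungs: CM
models exist for all CM-quasi-excellent X (arXiv:1810.04493 Thm 1.6); all rungs hold in dim ≤ 3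
(arXiv:1412.0868 Thm 1.1 + RegularStalksClimb).
Items at open: 6 (3 cruxes, 2 supports, 1 assembly); after the cone repair 2026-08-16: still 6 (3
cruxes restated in transport-closed form, 2 supports, 1 assembly;
the Assembly item is now literally the type of the deciding theorem `closes` and is provable by it,
D-0027). After the judge repair 2026-08-17: 8 active items (3 cruxes, 4 supports —
RegularStalksClimb and CPSpecimenNotFClosed proved, ThreefoldFInjectiveBlowup and
ThreefoldStrictTransformFedder open —, 1 assembly (proved)); `closes` unchanged (binders = the 3
cruxes). Import cone after repair: the Statement's own module only
(Literature…Resolution.ResolutionOfSingularities, which also declares the named fact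
CossartPiltant2019 — not a hypothesis of any item).

DEFINITION REQUESTS. None blocking (rungs are typed inline over Mathlib: ringKrullDim,
Ideal.span/radical, RingTheory.Sequence.IsWeaklyRegular). Wanted later
for readability (to be filed as definition items, Literature/CommutativeAlgebra/TightClosure):
`tightClosure I`, `frobeniusClosure I`,
`IsFRational R`, `IsFInjective R` (via Mathlib `localCohomology` + Frobenius action), with the
equivalences HH94 Thm 4.2 / Fedder 1983 as
named facts; cite facts wanted: Kawasaki2000 Thm 1.1 / Cesnavicius2021 Thm 1.6 (Macaulayfication),
BST2015 Cor (F-rational via alterations).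

Novelty: Searches (2026-08-16; local searchd down — rc ConnectionReset — so `lit search --source
zbmath|arxiv`, `lit galaxy search --star all`,
`lit vsearch`, `lit frontier --since 2022`, `lit bridges --cross any`, `lit read` of
arXiv:1810.04493 pp.1-4, arXiv:1107.3807 pp.1-4,
arXiv:1601.02524 pp.1-4, arXiv:1310.0584 (all), arXiv:2305.12383 pp.1-3, arXiv:1803.05382 pp.1-2,
arXiv:1503.06320 pp.1-2): zbMATH
"F-rationality of Rees algebras" (8: HWY02, Bruns–Conca 98, KK21, Kotal–Kummini 24, Watanabe 97, …),
"Macaulayfication" (6: Kawasaki 00/02,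
Schenzel 04, Faltings 78, Cuong–Cuong 17, Brodmann 77), "Macaulayfication F-rational" (AHS96,
Aberbach 96, Kurano 97), "F-rational
modification" (1, unrelated), "F-injective blow-up" (0), "F-rational birational model existence"
(0), "Frobenius closure parameter ideals
blowing up" (0); arXiv "F-rationalification" (2: Berquist = Kollár's char-0 rationalification),
"F-injective modification blow-up" (0);
galaxy --star all "Macaulayfication" (15 rows: Schenzel LNM 907, CIME 2283, Bhatt 2008.08070 …, none
on F-singularity models); vsearch (8
textbook hits, none relevant); frontier since 2022 (30 rows; nearest arXiv:2602.06553 ranking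
functions — unrelated mechanism).
Nearest prior art found: arXiv:1810.04493 / doi:10.1090/s0002-9947-00-02603-9 /
doi:10.1007/bf01424774 (the CM rung, printed as a
weak-resolution strategy); zbl:0910.13005 AHS96 and doi:10.1006/jabr.2001.8998, arXiv:1803.05382,
arXiv:2305.12383 (tight closure decides
CM-ness / F-rationali  [refs: 10.1090/s0002-9947-00-02603-9, 10.1007/bf01424774, 10.1006/jabr.2001.8998, 1810.04493, 1107.3807, 1601.02524, 1310.0584, 2305.12383, 1803.05382, 1503.06320, 2602.06553, doi:10.1090/s0002-9947-00-02603-9, doi:10.1007/bf01424774, doi:10.1006/jabr.2001.8998]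

Barriers (technique_class: homological-ladder macaulayfication-transfer tight-closure): - technique_class: homological-ladder macaulayfication-transfer tight-closure
- Literature.Barriers.ResolutionOfSingularities.Hauser2003_kangarooShadeIncrease: evaded by location
for ranks 2–3 (no order/residual-order invariant, no regular centres: centres are non-reduced
parameter-type ideals chosen homologically); its specimen x²+y⁷+yz⁴ lies in m^[2], is not
F-injective-CM, and is modified away by rank 2; it returns, restricted to F-regular germs, as the
honest risk of rank 4.
- Literature.Barriers.ResolutionOfSingularities.hauserPerlega_mohProofBoundFails: same — the
Hauser–Perlega family z^8 + x^(8a+4)… lies in m^[2]; the bet for rank 4 is that residual-order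
divergence needs F-impurity (testable, Cheapest falsifier (ii)).
- Literature.Barriers.ResolutionOfSingularities.Narasimhan1983_noSmoothHypersurfaceThroughTopLocus:
not met by ranks 2–3 (no maximal contact); for rank 4, F-rational hypersurface points have
multiplicity ≤ dim+1 so maximal contact exists when p > dim+1, and Narasimhan's polynomial is in
m^[2] (excluded); for p ≤ dim+1 it does bite rank 4; the bet is the smaller class.
- Literature.Barriers.ResolutionOfSingularities.hironakaQuadric_directrixZero_and_nearPoint: the
quadric X²+λY²+μZ²+λμW² (char 2) is in m^[2], excluded from the residual class; not met by ranks
2–3.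
- Literature.Barriers.ResolutionOfSingularities.DimensionFourFrontier: it does apply as state of
knowledge — nothing above CM is known in dim ≥ 4; ranks 2–3 are dimension-free statements whose

History (route lifecycle, newest last):
- 2026-08-16T15:22:31Z · rev 1: restated FInjectiveMacaulayfication (stmt-ResolutionOfSingularities-15331), FRationalModification (stmt-ResolutionOfSingularities-15332), FRationalResolution (stmt-ResolutionOfSingularities-15333) — cone repair (unit rrepair-ResolutionOfSingularities-Frob-1a7e6e9d, D-0023 Phase-C guardrail): (a) dropped the rout (planner-rrepair-ResolutionOfSingularities-Frob-1a7e6e9d-0)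
- 2026-08-25T08:06:05Z · DORMANT — reconciler: no traction for 7.5 d (last activity item-evidence-added at 2026-08-17T19:05:29Z); parked, not closed — `ledger route dormant route-ResolutionOfSing (operator:999:3589658)
- 2026-08-26T16:26:02Z · REACTIVATED — dormant cleared (operator:999:1107126)

sub-problem: ResolutionOfSingularities · status: open · opened planner-plan-novel-ResolutionOfSingularities-Re-dc19aa3a-b-g2-0 2026-08-16T15:01:37Z · rev 3 · ledger route-ResolutionOfSingularities-FrobeniusLadder
GENERATED by the gate from the ledger (D-0016/17). Provers cite these decls: `theorem foo : Summit.ResolutionOfSingularities.ResolutionOfSingularities.Theses.FrobeniusLadder.<Decl> := …` in Summits/ResolutionOfSingularities/ResolutionOfSingularities/Theorems/<Name>.lean.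
-/

namespace Summit.ResolutionOfSingularities.ResolutionOfSingularities.Theses.FrobeniusLadder

open scoped BigOperators Topology Manifold Classical MeasureTheory ProbabilityTheory Matrix InnerProductSpace ComplexConjugate ContinuousMap
open Filter Set Function TopologicalSpace MeasureTheory

attribute [summit_statement] _root_.ResolutionOfSingularities

-- earlier FInjectiveMacaulayfication (stmt-ResolutionOfSingularities-15331, replaced 2026-08-16T15:22:31Z -> stmt-ResolutionOfSingularities-15315): retired by None — ∀ p : ℕ, p.Prime → ∀ (k : Type) [Field k] [CharP k p] (X : AlgebraicGeometry.Scheme.{0}) (f : X ⟶ AlgebraicGeometry.Spec (.of k)), AlgebraicGeometry.IsSeparated f → AlgebraicGeometry.LocallyOfFiniteType f → AlgebraicGeometry.QuasiCompac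
/-- item stmt-ResolutionOfSingularities-15315 · crux · rank 2 · open · by planner
why it might fail: Kawasaki's lemma is a depth statement (H^i_m, i<d); the Frobenius kernel on the TOP H^d_m is not: point centres F-injectivize isolated germs (E8 char 5; the char-2 threefold filed) but die once the bad locus is a curve (j023222), and no centre recipe with a decreasing measure is known.
sources: doi:10.1090/s0002-9947-00-02603-9, arXiv:1810.04493, doi:10.1007/bf01424774, doi:10.2307/1999165, arXiv:1601.02524, arXiv:0708.0553
[crux] F-INJECTIVE MACAULAYFICATION (transport-closed form over reduced X; cone repair 2026-08-16).
For every prime p, field k of char p and reduced separated k-scheme X of finite type there is a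
proper birational π : X' → X such that every local ring O_{X',x} is a domain (X' locally integral)
and for every system of parameters s of O_{X',x} (d = dim O_{X',x} elements generating an ideal with
maximal radical) s is a regular sequence and (s) is Frobenius closed (y^(p^e) ∈ (s)^[p^e] ⇒ y ∈ (s))
— X' is locally integral, Cohen–Macaulay and F-injective (the transferred Kawasaki engine one rung
up). Equivalent to the integral form (integral X, integral X') modulo in-tree folklore (integral
components with reduced structure; disjoint union of the components' models: Literature
isProper_coprodDesc / isBirational_coprodDesc_of_closed_cover); stated over reduced X so that the
route's deciding theorem is pure logic over the Statement's module. [difficulty: open-problem] -/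
@[route_item "route-ResolutionOfSingularities-FrobeniusLadder", crux (bottleneck := idea) (experiment := "instrument: (53rd registration = the one open clock, unblocked by window #10; nose / iso residues IDEA-NEEDED-with-instrument per desk l.39322) · **153…") (source := "director HOURLY-RESOLUTION l.1136, 2026-09-01")]
def FInjectiveMacaulayfication : Prop :=
  ∀ p : ℕ, p.Prime → ∀ (k : Type) [Field k] [CharP k p] (X : AlgebraicGeometry.Scheme.{0}) (f : X ⟶ AlgebraicGeometry.Spec (.of k)), AlgebraicGeometry.IsSeparated f → AlgebraicGeometry.LocallyOfFiniteType f → AlgebraicGeometry.QuasiCompact f → AlgebraicGeometry.IsReduced X → ∃ (X' : AlgebraicGeometry.Scheme.{0}) (π : X' ⟶ X), AlgebraicGeometry.IsProper π ∧ Literature.AlgebraicGeometry.Resolution.IsBirational π ∧ ∀ x : X', IsDomain (X'.presheaf.stalk x) ∧ ∀ d : ℕ, ringKrullDim (X'.presheaf.stalk x) = d → ∀ s : Fin d → X'.presheaf.stalk x, (Ideal.span (Set.range s)).radical.IsMaximal → RingTheory.Sequence.IsWeaklyRegular (X'.presheaf.stalk x) (List.ofFn s) ∧ ∀ y : X'.presheaf.stalk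 x, (∃ e : ℕ, y ^ p ^ e ∈ Ideal.span ((fun z : X'.presheaf.stalk x => z ^ p ^ e) '' (Ideal.span (Set.range s) : Set (X'.presheaf.stalk x)))) → y ∈ Ideal.span (Set.range s)

-- earlier FRationalModification (stmt-ResolutionOfSingularities-15332, replaced 2026-08-16T15:22:31Z -> stmt-ResolutionOfSingularities-15316): retired by None — ∀ p : ℕ, p.Prime → ∀ (k : Type) [Field k] [CharP k p] (X : AlgebraicGeometry.Scheme.{0}) (f : X ⟶ AlgebraicGeometry.Spec (.of k)), AlgebraicGeometry.IsSeparated f → AlgebraicGeometry.LocallyOfFiniteType f → AlgebraicGeometry.QuasiCompact f →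
/-- item stmt-ResolutionOfSingularities-15316 · crux · rank 3 · open · by planner
why it might fail: no ideal I with Proj R[It] F-rational is known for a non-F-rational R beyond dim 2 (Lipman); Rees algebras even of F-rational rings fail F-rationality (HWY02), and the test module τ(ω) can stay strictly inside ω along every normal modification tower (two-chains stagnation).
sources: doi:10.2307/2154942, arXiv:1107.3807, doi:10.1006/jabr.2001.8998, arXiv:2305.12383, arXiv:1803.05382, zbl:0910.13005
[crux] F-RATIONALIFICATION OF CM F-INJECTIVE VARIETIES (transport-closed form; cone repair
2026-08-16). For every prime p, field k of char p and reduced separated finite-type X/k: if X admits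
a proper birational model X₁ → X that is locally integral with all local rings CM and all parameter
ideals Frobenius closed (the rung-2 predicate verbatim), then X admits a proper birational model X₂
→ X all of whose local rings are domains in which every ideal generated by a system of parameters is
tightly closed (c·y^(p^e) ∈ (s)^[p^e] for all e with c ≠ 0 ⇒ y ∈ (s)) — X₂ is F-rational (card
test-module-two-chains' rung FRat, all dimensions; engine: parameter test elements as the uniform
annihilator of 0^*_{H^d_m} in Kawasaki's induction, BST trace surjectivity as the target).
Equivalent to 'every integral CM F-injective variety has a proper birational F-rational model'
modulo folklore (a locally integral Noetherian scheme is the disjoint union of its clopen integral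
components; composition of proper birational maps, Literature IsBirational.comp). [deps:
FInjectiveMacaulayfication] [difficulty: open-problem] -/
@[route_item "route-ResolutionOfSingularities-FrobeniusLadder", crux]
def FRationalModification : Prop :=
  ∀ p : ℕ, p.Prime → ∀ (k : Type) [Field k] [CharP k p] (X : AlgebraicGeometry.Scheme.{0}) (f : X ⟶ AlgebraicGeometry.Spec (.of k)), AlgebraicGeometry.IsSeparated f → AlgebraicGeometry.LocallyOfFiniteType f → AlgebraicGeometry.QuasiCompact f → AlgebraicGeometry.IsReduced X → (∃ (X' : AlgebraicGeometry.Scheme.{0}) (π : X' ⟶ X), AlgebraicGeometry.IsProper π ∧ Literature.AlgebraicGeometry.Resolution.IsBirational π ∧ ∀ x : X', IsDomain (X'.presheaf.stalk x) ∧ ∀ d : ℕ, ringKrullDim (X'.presheaf.stalk x) = d → ∀ s : Fin d → X'.presheaf.stalk x, (Ideal.span (Set.range s)).radical.IsMaximal → RingTheory.Sequence.IsWeaklyRegular (X'.presheaf.stalk x) (List.ofFn s) ∧ ∀ y : X'.presheaf.stalk x, (∃ e : ℕ, y ^ p ^ e ∈ Ideal.span ((fun z : X'.presheaf.stalk x =>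 z ^ p ^ e) '' (Ideal.span (Set.range s) : Set (X'.presheaf.stalk x)))) → y ∈ Ideal.span (Set.range s)) → ∃ (X' : AlgebraicGeometry.Scheme.{0}) (π : X' ⟶ X), AlgebraicGeometry.IsProper π ∧ Literature.AlgebraicGeometry.Resolution.IsBirational π ∧ ∀ x : X', IsDomain (X'.presheaf.stalk x) ∧ ∀ d : ℕ, ringKrullDim (X'.presheaf.stalk x) = d → ∀ s : Fin d → X'.presheaf.stalk x, (Ideal.span (Set.range s)).radical.IsMaximal → ∀ y c : X'.presheaf.stalk x, c ≠ 0 → (∀ e : ℕ, c * y ^ p ^ e ∈ Ideal.span ((fun z : X'.presheaf.stalk x => z ^ p ^ e) '' (Ideal.span (Set.range s) : Set (X'.presheaf.stalk x)))) → y ∈ Ideal.span (Set.range s)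

-- earlier FRationalResolution (stmt-ResolutionOfSingularities-15333, replaced 2026-08-16T15:22:31Z -> stmt-ResolutionOfSingularities-15317): retired by None — ∀ p : ℕ, p.Prime → ∀ (k : Type) [Field k] [CharP k p] (X : AlgebraicGeometry.Scheme.{0}) (f : X ⟶ AlgebraicGeometry.Spec (.of k)), AlgebraicGeometry.IsSeparated f → AlgebraicGeometry.LocallyOfFiniteType f → AlgebraicGeometry.QuasiCompact f → A
/-- item stmt-ResolutionOfSingularities-15317 · crux · rank 4 · open · by planner
why it might fail: F-rationality is no restriction in codimension ≥ 2 phenomena of toric/determinantal type and carries no known resolution invariant; F-regular hypersurface germs z^p + F (n ≥ p+1 variables, e.g. z²+xyw+G in char 2) may still host kangaroo-type residual-order jumps.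
sources: arXiv:1310.0584, doi:10.1353/ajm.1997.0007, doi:10.2307/1999165, arXiv:1412.0868, Kollar2007, arXiv:0807.1654
[crux] RESOLUTION OF F-RATIONAL VARIETIES (transport-closed form; cone repair 2026-08-16). For every
prime p, field k of char p and reduced separated finite-type X/k: if X admits a proper birational
model X₂ → X all of whose local rings are domains with every parameter ideal tightly closed
(F-rational), then X has a resolution of singularities (proper birational X̃ → X, X̃ regular).
Equivalent to 'every integral F-rational variety has a resolution' modulo folklore (Literature
Scheme.HasResolution.of_isBirational; clopen integral components). Ranked last deliberately: it is
the summit restricted to the residual class; the route-specific information is in ranks 2–3. [deps: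
FRationalModification] [difficulty: open-problem] -/
@[route_item "route-ResolutionOfSingularities-FrobeniusLadder", crux]
def FRationalResolution : Prop :=
  ∀ p : ℕ, p.Prime → ∀ (k : Type) [Field k] [CharP k p] (X : AlgebraicGeometry.Scheme.{0}) (f : X ⟶ AlgebraicGeometry.Spec (.of k)), AlgebraicGeometry.IsSeparated f → AlgebraicGeometry.LocallyOfFiniteType f → AlgebraicGeometry.QuasiCompact f → AlgebraicGeometry.IsReduced X → (∃ (X' : AlgebraicGeometry.Scheme.{0}) (π : X' ⟶ X), AlgebraicGeometry.IsProper π ∧ Literature.AlgebraicGeometry.Resolution.IsBirational π ∧ ∀ x : X', IsDomain (X'.presheaf.stalk x) ∧ ∀ d : ℕ, ringKrullDim (X'.presheaf.stalk x) = d → ∀ s : Fin d → X'.presheaf.stalk x, (Ideal.span (Set.range s)).radical.IsMaximal → ∀ y c : X'.presheaf.stalk x, c ≠ 0 → (∀ e : ℕ, c * y ^ p ^ e ∈ Ideal.span ((fun z : X'.presheaf.stalk x => z ^ p ^ e) '' (Ideal.span (Set.range s) : Set (X'.presheaf.stalk x)))) → y ∈ Ideal.span (Set.range s)) → Literature.AlgebraicGeometry.Resolution.Scheme.HasResolution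 X

/-- item stmt-ResolutionOfSingularities-15334 · support · rank 9 · closed · proved by Summit.ResolutionOfSingularities.ResolutionOfSingularities.Theorems.RegularStalksClimb_proof @ b94343e59a48 (prover) · by planner
sources: doi:10.2307/2154942, doi:10.2307/1971025, Literature.AlgebraicGeometry.Resolution.KunzRegularityCriterion
[support] FAITHFULNESS (regular local rings sit on top of the ladder): for every prime p and every
Noetherian regular local ring R of characteristic p, every system of parameters is a regular
sequence and every ideal it generates is tightly closed (hence Frobenius closed); so the summit
implies each crux (take X' = a resolution). Proof route: Kunz flatness of Frobenius (Literature
KunzRegularityCriterion*) gives (I^[q] : y^q) = (I : y)^[q], then Krull intersection. [difficulty: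
M] -/
@[route_item "route-ResolutionOfSingularities-FrobeniusLadder"]
def RegularStalksClimb : Prop :=
  ∀ p : ℕ, p.Prime → ∀ (R : Type) [CommRing R] [IsNoetherianRing R] [IsLocalRing R] [CharP R p], IsRegularLocalRing R → ∀ d : ℕ, ringKrullDim R = d → ∀ s : Fin d → R, (Ideal.span (Set.range s)).radical.IsMaximal → RingTheory.Sequence.IsWeaklyRegular R (List.ofFn s) ∧ ∀ y c : R, c ≠ 0 → (∀ e : ℕ, c * y ^ p ^ e ∈ Ideal.span ((fun z : R => z ^ p ^ e) '' (Ideal.span (Set.range s) : Set R))) → y ∈ Ideal.span (Set.range s)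

-- `RegularStalksClimb` holds: proved by `Summit.ResolutionOfSingularities.ResolutionOfSingularities.Theorems.RegularStalksClimb_proof` @ b94343e59a48 (its module imports this route file, so no `_holds` link can be stated here).

/-- item stmt-ResolutionOfSingularities-15335 · support · rank 9 · closed · proved by Summit.ResolutionOfSingularities.ResolutionOfSingularities.Theorems.cpSpecimenNotFClosed_proof @ 98f7563f3d17 (prover) · by planner
sources: arXiv:1412.0868, doi:10.2307/1999165
[support] CALIBRATION (the wild core is below rung 2): for the Cossart–Piltant Rem 3.2 hypersurface
A = k[u₁,…,u₄,Z]/(Z^p + u₄u₁^p + u₃u₂^p) over any field k of char p, the parameter ideal I =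
(u₁,u₂,u₃,u₄) is NOT Frobenius closed: Z ∉ I but Z^p ∈ I^[p]. Hence the local ring at the origin is
not F-injective-CM and FInjectiveMacaulayfication must modify such points away (same two-line
computation for every barrier-catalogue specimen lying in m^[p]). [difficulty: provable-now] -/
@[route_item "route-ResolutionOfSingularities-FrobeniusLadder"]
def CPSpecimenNotFClosed : Prop :=
  ∀ p : ℕ, p.Prime → ∀ (k : Type) [Field k] [CharP k p], let f : MvPolynomial (Fin 5) k := MvPolynomial.X 4 ^ p + MvPolynomial.X 3 * MvPolynomial.X 0 ^ p + MvPolynomial.X 2 * MvPolynomial.X 1 ^ p; let A := MvPolynomial (Fin 5) k ⧸ Ideal.span {f}; let u : Fin 5 → A := fun i => Ideal.Quotient.mk (Ideal.span {f}) (MvPolynomial.X i); let I : Ideal A := Ideal.span {u 0, u 1, u 2, u 3}; u 4 ∉ I ∧ u 4 ^ p ∈ Ideal.span ((fun z : A => z ^ p) '' (I : Set A))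

-- `CPSpecimenNotFClosed` holds: proved by `Summit.ResolutionOfSingularities.ResolutionOfSingularities.Theorems.cpSpecimenNotFClosed_proof` @ 98f7563f3d17 (its module imports this route file, so no `_holds` link can be stated here).

/-- item stmt-ResolutionOfSingularities-17936 · support · rank 9 · closed · proved by Summit.ResolutionOfSingularities.ResolutionOfSingularities.Theorems.FInjectiveMacaulayfication.ThreefoldFiModel.threefoldFInjectiveBlowup_proof (prover) · by planner
sources: doi:10.2307/1999165, arXiv:1601.02524, doi:10.1006/jabr.1998.7521, StacksProject Tag 0804, arXiv:1810.04493
[support] THREEFOLD CALIBRATION — the judge's Attack-axis first lemma for crux #2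
FInjectiveMacaulayfication (judge pass 2026-08-17 06:45Z, what_would_move_it: 'an explicit blow-up
shrinking the Frobenius kernel on H^d_m while preserving CM for one non-F-injective 3-fold germ').
Germ (char 2): f = X₀²X₁+X₁²X₂+X₂²X₀+X₀X₃³+X₁X₂X₃², A = k[X₀..X₃]/(f) — integral (c =
X₀²X₁+X₁²X₂+X₂²X₀ is a smooth plane cubic and c ∤ X₀X₃³+X₁X₂X₃²), isolated triple point at 0 (∂f =
(X₂²+X₃³, X₀²+X₂X₃², X₁²+X₁X₃², X₀X₃²) vanish together only at 0), Cohen–Macaulay, NOT F-injective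
at 0 since f ∈ m^[2] (Fedder). Conjunct (a), provable now: the parameter ideal I = (x₀+x₁, x₂, x₃)
(A/I = k[x₀]/(x₀³), so rad I is the maximal ideal of the origin and x₀² ∉ I) has (x₀²)² ∈ I^[2] (x₀⁴
= (x₀+(x₀+x₁)+x₂)·f + element of ((x₀+x₁)², x₂², x₃²)). Conjunct (b): Spec A has a proper birational
model X' all of whose stalks are domains with every s.o.p. weakly regular and every parameter ideal
Frobenius closed (the rung-2 clause verbatim, p = 2) and X' is NOT regular. Witness: X' = Bl_m Spec
A = affineBlowup (x₀,x₁,x₂,x₃), by E6′ BlowupFiModel.blowupFiModel_of_maximal (p = 2, r = 4): off m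
the ring A is regular (Jacobian, as -/
@[route_item "route-ResolutionOfSingularities-FrobeniusLadder"]
def ThreefoldFInjectiveBlowup : Prop :=
  ∀ (k : Type) [Field k] [CharP k 2], let f : MvPolynomial (Fin 4) k := MvPolynomial.X 0 ^ 2 * MvPolynomial.X 1 + MvPolynomial.X 1 ^ 2 * MvPolynomial.X 2 + MvPolynomial.X 2 ^ 2 * MvPolynomial.X 0 + MvPolynomial.X 0 * MvPolynomial.X 3 ^ 3 + MvPolynomial.X 1 * MvPolynomial.X 2 * MvPolynomial.X 3 ^ 2; let A := MvPolynomial (Fin 4) k ⧸ Ideal.span {f}; let u : Fin 4 → A := fun i => Ideal.Quotient.mk (Ideal.span {f}) (MvPolynomial.X i); let I : Ideal A := Ideal.span {u 0 + u 1, u 2, u 3}; (I.radical.IsMaximal ∧ u 0 ^ 2 ∉ I ∧ (u 0 ^ 2) ^ 2 ∈ Ideal.span ((fun z : A => z ^ 2) '' (I : Set A))) ∧ ∃ (X' : AlgebraicGeometry.Scheme.{0}) (π : X' ⟶ AlgebraicGeometry.Spec (.of A)), AlgebraicGeometry.IsProper π ∧ Literature.AlgebraicGeometry.Resolution.IsBirational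 π ∧ ¬ Literature.AlgebraicGeometry.Resolution.Scheme.IsRegular X' ∧ ∀ x : X', IsDomain (X'.presheaf.stalk x) ∧ ∀ d : ℕ, ringKrullDim (X'.presheaf.stalk x) = d → ∀ s : Fin d → X'.presheaf.stalk x, (Ideal.span (Set.range s)).radical.IsMaximal → RingTheory.Sequence.IsWeaklyRegular (X'.presheaf.stalk x) (List.ofFn s) ∧ ∀ y : X'.presheaf.stalk x, (∃ e : ℕ, y ^ 2 ^ e ∈ Ideal.span ((fun z : X'.presheaf.stalk x => z ^ 2 ^ e) '' (Ideal.span (Set.range s) : Set (X'.presheaf.stalk x)))) → y ∈ Ideal.span (Set.range s)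

-- `ThreefoldFInjectiveBlowup` holds: proved by `Summit.ResolutionOfSingularities.ResolutionOfSingularities.Theorems.FInjectiveMacaulayfication.ThreefoldFiModel.threefoldFInjectiveBlowup_proof` (its module imports this route file, so no `_holds` link can be stated here).

/-- item stmt-ResolutionOfSingularities-17937 · support · rank 9 · closed · proved by Summit.ResolutionOfSingularities.ResolutionOfSingularities.Theorems.FInjectiveMacaulayfication.ThreefoldStrictTransformFedder.threefoldStrictTransformFedder_proof (prover) · by planner
sources: doi:10.2307/1999165, arXiv:1601.02524
[support] THE FEDDER FLIP, polynomial level — the computational heart of ThreefoldFInjectiveBlowup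
(provable now; templates CPSpecimenNotFClosed, E8Forms, FedderOrigin.e8_pow_four_mem /
e7_fedder_char5). For every field k of char 2, f = X₀²X₁+X₁²X₂+X₂²X₀+X₀X₃³+X₁X₂X₃² and g =
X₀²X₁+X₁²X₂+X₂²X₀+X₀X₃+X₁X₂X₃ in k[X₀..X₃]: (i) f ∈ (X₀²,X₁²,X₂²,X₃²) — Fedder's test FAILS at the
input point (p − 1 = 1), so by FedderOrigin.fedder_criterion_origin the origin of Spec k[X]/(f)
violates the rung-2 clause; (ii) aeval θ₃ f = X₃³·g for θ₃ : X₃ ↦ X₃, Xⱼ ↦ XⱼX₃ (j ≠ 3) — g is the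
strict transform of f on the X₃-chart of the blow-up of the origin (multiplicity 3); (iii) g ∉
(X₀²,…,X₃²) — Fedder's test PASSES at the origin of the chart (squarefree monomials X₀X₃, X₁X₂X₃),
so the clause HOLDS at the new point; (iv) g ∈ (X₀,…,X₃)² — the new point is singular (no resolution
happened); (v) ∂₁g − X₀², ∂₂g − X₁², ∂₀g − X₂² ∈ (X₃) — Jacobian certificates: every exceptional
prime of the chart not containing (X₀,X₁,X₂) is a regular point. [deps: —] [difficulty:
provable-now] -/
@[route_item "route-ResolutionOfSingularities-FrobeniusLadder"]
def ThreefoldStrictTransformFedder : Prop :=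
  ∀ (k : Type) [Field k] [CharP k 2], let f : MvPolynomial (Fin 4) k := MvPolynomial.X 0 ^ 2 * MvPolynomial.X 1 + MvPolynomial.X 1 ^ 2 * MvPolynomial.X 2 + MvPolynomial.X 2 ^ 2 * MvPolynomial.X 0 + MvPolynomial.X 0 * MvPolynomial.X 3 ^ 3 + MvPolynomial.X 1 * MvPolynomial.X 2 * MvPolynomial.X 3 ^ 2; let g : MvPolynomial (Fin 4) k := MvPolynomial.X 0 ^ 2 * MvPolynomial.X 1 + MvPolynomial.X 1 ^ 2 * MvPolynomial.X 2 + MvPolynomial.X 2 ^ 2 * MvPolynomial.X 0 + MvPolynomial.X 0 * MvPolynomial.X 3 + MvPolynomial.X 1 * MvPolynomial.X 2 * MvPolynomial.X 3; f ∈ Ideal.span (Set.range fun i : Fin 4 => (MvPolynomial.X i : MvPolynomial (Fin 4) k) ^ 2) ∧ MvPolynomial.aeval (fun j : Fin 4 => if j = 3 then (MvPolynomial.X 3 : MvPolynomial (Fin 4) k) else MvPolynomial.X j * MvPolynomial.X 3) f = MvPolynomial.X 3 ^ 3 * g ∧ g ∉ Ideal.span (Set.range fun i : Fin 4 => (MvPolynomial.X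 i : MvPolynomial (Fin 4) k) ^ 2) ∧ g ∈ Ideal.span (Set.range (MvPolynomial.X : Fin 4 → MvPolynomial (Fin 4) k)) ^ 2 ∧ (MvPolynomial.pderiv 1 g - MvPolynomial.X 0 ^ 2 ∈ Ideal.span {(MvPolynomial.X 3 : MvPolynomial (Fin 4) k)} ∧ MvPolynomial.pderiv 2 g - MvPolynomial.X 1 ^ 2 ∈ Ideal.span {(MvPolynomial.X 3 : MvPolynomial (Fin 4) k)} ∧ MvPolynomial.pderiv 0 g - MvPolynomial.X 2 ^ 2 ∈ Ideal.span {(MvPolynomial.X 3 : MvPolynomial (Fin 4) k)})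

-- `ThreefoldStrictTransformFedder` holds: proved by `Summit.ResolutionOfSingularities.ResolutionOfSingularities.Theorems.FInjectiveMacaulayfication.ThreefoldStrictTransformFedder.threefoldStrictTransformFedder_proof` (its module imports this route file, so no `_holds` link can be stated here).

/-- item stmt-ResolutionOfSingularities-15336 · assembly · rank 1 · closed · proved by Summit.ResolutionOfSingularities.ResolutionOfSingularities.Theorems.frobeniusLadder_assembly_proof @ 4f836ec6faf4 (prover) · by planner
sources: arXiv:1412.0868, Kollar2007
[assembly] FInjectiveMacaulayfication → FRationalModification → FRationalResolution →
ResolutionOfSingularities. -/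
@[route_item "route-ResolutionOfSingularities-FrobeniusLadder"]
def Assembly : Prop :=
  FInjectiveMacaulayfication → FRationalModification → FRationalResolution → _root_.ResolutionOfSingularities

-- `Assembly` holds: proved by `Summit.ResolutionOfSingularities.ResolutionOfSingularities.Theorems.frobeniusLadder_assembly_proof` @ 4f836ec6faf4 (its module imports this route file, so no `_holds` link can be stated here).

/-! D-0027 §2.1 — DECIDING THEOREM (planner-authored via `route open/edit --closes-file`; by planner-rrepair-ResolutionOfSingularities-Frob-1a7e6e9d-0 2026-08-16T15:22:31Z):
its hypotheses are this route's items and its conclusion the sub-problem Statement (glue_lint), and it elaborates with this file. -/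

@[closes "route-ResolutionOfSingularities-FrobeniusLadder"] theorem closes (hFI : FInjectiveMacaulayfication) (hFR : FRationalModification)
    (hRes : FRationalResolution) : _root_.ResolutionOfSingularities := by
  rw [_root_.ResolutionOfSingularities_iff]
  intro p hp k _ _ X f hsep hft hqc hred
  exact hRes p hp k X f hsep hft hqc hred (hFR p hp k X f hsep hft hqc hred (hFI p hp k X f hsep hft hqc hred))

end Summit.ResolutionOfSingularities.ResolutionOfSingularities.Theses.FrobeniusLadder
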